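import Summits.BirchSwinnertonDyer.BirchSwinnertonDyer.Theorems.ErratumRoadFiveNonSurjCornerHybridLabelsOnlyX11aByName
import Summits.BirchSwinnertonDyer.BirchSwinnertonDyer.Theorems.ErratumRoadFiveEulerHalfNotRamLABIndexGuard
import HarnessLib

/-!
# Route `ErratumRoadFive` (rung K2), crux `NonSurjCorner` (item stmt-BirchSwinnertonDyer-19065): THE HYBRID LINE AS A COMPOSITION OF ROUTE ITEMS ONLY —
# `NonSurjCorner` from NINE registered decls of `Theses/ErratumRoadFive.lean` (after RULING 65's two new items) + ONE displayed binder (the fifteen twin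
# facts = the planner's deferred child item `KatoTwinFactsFiveAnContra`, RULING 65 phase 1b)
# (cell `bsd-stepL`, seat `bsd-stepL-corner-p1` g17; `--supports stmt-BirchSwinnertonDyer-19065 --as helper`; offered for the planner's re-split of 19065)

WHY THIS FILE. After r17 the hybrid line's composition (glue #19′, `…HybridLabelsOnlyX11aByName`) binds: the deep Kolyvagin certificates (⟸ item 19946
`NonSurjCornerKolyZ` a fortiori), item 19948 `NonSurjCornerTwinMuAn`, the fifteen twin ∕ MAX facts (DISPLAYED — the planner's items-cap deferred `KatoTwinFactsFiveAnContra` to the 19065 re-split, where it becomes a child),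
the crux `X11aLowerHalf` (19064), the two MAX-road names image-free (= item `EulerHalfGrossPrintFacts`, RULING 65 (i)), four Shimura names (Friedberg–Hoffstein
inert = conjunct 13 of item 19066 `PublishedInputsFive`; `ShimuraParametrizationDataNonempty`; `PastenComponentOrdersInput`; `ShimuraCasselsTateLevelInputs`),
and slot 6 — the (B6)@carriers labelled family on the corner, which FOLLOWS from item `ShimuraCarrierLabelsB6FromFive` (RULING 65 (ii), filed with the INDEX-FREE LAB text: image-free, `p ≥ 5`, `d_K < −4`) through
the lead's `EulerHalfLABIndexGuard.carrierLabelsB6AtFive_of_indexFree` (p634249; the index guard re-derived in the kernel from conjuncts 7 and 6 of 19066)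
and instantiation at `p ∈ {5,7}`. So:
* **`nonSurjCorner_of_routeItems : NonSurjCornerKolyZ → NonSurjCornerTwinMuAn → PublishedInputsFive → ‹fifteen twin facts› → X11aLowerHalf →
  EulerHalfGrossPrintFacts → ShimuraParametrizationDataNonempty → PastenComponentOrdersInput → ShimuraCasselsTateLevelInputs →
  ShimuraCarrierLabelsB6FromFive → NonSurjCorner`** — nine route items BY NAME + the one displayed bundle the planner will itemise as a CHILD of the
  19065 re-split (then a one-token edit makes it the glue's proof-of-item).
For the planner (D-0145 ∕ RULING 21 — nothing is filed or registered here): 19065 can be RE-SPLIT into these nine existing items + the Kato child + ONE glue item with this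
statement, closed `--by` (the one-token edit of) this theorem; the crux's open content is then carried by its open children {19946 (deep Kolyvagin certificates; converse-grade),
19948 (μ = 0 at the leaf twins; per pair decidable), 19064 (rung K6's crux), `ShimuraCarrierLabelsB6FromFive` ((B6)@carriers; refereed written proof)}
and the cite-only support items. Alternative keeping 19064 OUT of the cone (RULING 48): file a six-name Hida support item and use glue #19 instead
(`…HybridLabelsOnly`); one-token edit of this file.

HONEST FRAMING: ONE THEOREM (no definition, no named fact, no `sorry`); CONDITIONAL on nine route items (four of them OPEN mathematics) + one displayed cite-only bundle (19946, 19948, 19064,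
the (B6) item); item 19065 is NOT closed by this file (that is a registry act of the planner); nothing about any curve's BSD; BSD is not advanced; T7.
References (locators only): [cite: PastenShimura2024, Prop. 6.13, Lemma 6.18] [cite: Jetchev2008, Thm. 1.1, Cor. 1.5] [cite: Cha2005, Thm. 21, Rmk. 25]
[cite: Kato2004Asterisque, Thm. 12.4, §17.13] [cite: GrossLMS1991, §3 Prop. 3.7 (2)] [cite: CaiShuTian2014, Thm. 1.5] [cite: MilneADT2006, Ch. I Thm. 4.10(b)]
[cite: Miller2011LMS, Def. 1.1].
-/

set_option autoImplicit false
set_option linter.dupNamespace false -- `Summit.BirchSwinnertonDyer.BirchSwinnertonDyer` (summit = problem), tree-wide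

noncomputable section

open scoped Classical NumberField MatrixGroups ModularForm

namespace Summit.BirchSwinnertonDyer.BirchSwinnertonDyer.Theorems

open CongruenceSubgroup WeierstrassCurve NumberField IsDedekindDomain Field Rat.HeightOneSpectrum
  Literature.NumberTheory.EllipticCurves
  Literature.NumberTheory.EllipticCurves.ModularForms
  Literature.NumberTheory.Automorphic
  Literature.NumberTheory.EllipticCurves.Rank1Residual
  Literature.NumberTheory.EllipticCurves.Rank1Residual.Typed
  Literature.NumberTheory.GaloisRepresentations Literature.NumberTheory.GaloisCohomology
  Summit.BirchSwinnertonDyer.Rank1Residual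
  Summit.BirchSwinnertonDyer.Rank1Residual.X11b
  Summit.BirchSwinnertonDyer.Rank1Residual.X11b.Three.Koly
  Summit.BirchSwinnertonDyer.BirchSwinnertonDyer.Theses.ErratumRoadFive

/-- **`NonSurjCorner` FROM NINE ROUTE ITEMS + the fifteen twin facts.** The hybrid line r17 with every binder but one a registered decl of
`Theses/ErratumRoadFive.lean`: 19946 (restricted inside to the deep ∕ `Ш_an`-cut certificates), 19948, 19066 (conjuncts 6, 7, 13 used: GZK, entire `L`,
Friedberg–Hoffstein inert), ‹the fifteen twin facts, displayed›,
19064, `EulerHalfGrossPrintFacts`, `ShimuraParametrizationDataNonempty`, `PastenComponentOrdersInput`, `ShimuraCasselsTateLevelInputs`,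
`ShimuraCarrierLabelsB6FromFive` (INDEX-FREE LAB ⟹ the corner's slot 6 via `EulerHalfLABIndexGuard.carrierLabelsB6AtFive_of_indexFree` at `p ∈ {5,7}`). Then
glue #19′. CONDITIONAL on the nine items + the displayed bundle; 19065 NOT closed by this file; T7.
[cite: PastenShimura2024, Lemma 6.18] [cite: Jetchev2008, Thm. 1.1 and Cor. 1.5] [cite: Cha2005, Thm. 21 and Rmk. 25] [cite: Miller2011LMS, Def. 1.1] -/
theorem nonSurjCorner_of_routeItems
    (hZ : NonSurjCornerKolyZ) (hμ : NonSurjCornerTwinMuAn) (h₅ : PublishedInputsFive)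
    -- the fifteen twin ∕ MAX facts (= r14–r17 slot 3; the planner's deferred child item `KatoTwinFactsFiveAnContra`, RULING 65 phase 1b)
    (hF :
      (∀ (N : ℕ) [NeZero N] (W : WeierstrassCurve ℚ) (K : Type) [Field K] [NumberField K], Literature.NumberTheory.EllipticCurves.gross_zagier N W K) ∧
      (∀ (N : ℕ) [NeZero N] (W : WeierstrassCurve ℚ) (K : Type) [Field K] [NumberField K], Literature.NumberTheory.EllipticCurves.kolyvagin N W K) ∧
      Literature.NumberTheory.EllipticCurves.Wuthrich2014.sha_dvd_analyticSha ∧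
      Literature.NumberTheory.EllipticCurves.rank_eq_analyticRank_of_analyticRank_le_one ∧
      Literature.NumberTheory.EllipticCurves.ModularForms.exists_isNewformOf ∧
      Literature.NumberTheory.EllipticCurves.friedbergHoffstein_exists_heegnerField_split_twist_ne_zero ∧
      Literature.NumberTheory.EllipticCurves.ModularForms.mazur_not_dvd_maninConstant_of_odd ∧
      Literature.NumberTheory.EllipticCurves.SteinWuthrich2013.thm61_splitMultiplicative ∧
      Literature.NumberTheory.EllipticCurves.SteinWuthrich2013.thm61_nonsplitMultiplicative ∧
      (∀ (W : WeierstrassCurve ℚ) [W.IsElliptic] [W.IsGloballyMinimal] (p : ℕ) [Fact p.Prime], Literature.NumberTheory.EllipticCurves.greenberg_stevens (W := W) (p := p)) ∧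
      Literature.NumberTheory.EllipticCurves.Cha2005.rmk25_pow_dvd_card_sha_primary_of_certificate ∧
      Literature.NumberTheory.EllipticCurves.Kato2004.thm12_4 ∧
      Literature.NumberTheory.EllipticCurves.Kato2004.exists_multDivisibilityInputs_nonsplit_contra ∧
      Literature.NumberTheory.EllipticCurves.Kato2004.exists_multDivisibilityInputs_split_contra ∧
      Literature.NumberTheory.EllipticCurves.Kato2004.exists_multDivisibilityInputs_fine_contra)
    (h₃ : X11aLowerHalf) (hG : EulerHalfGrossPrintFacts)
    (hJL : ShimuraParametrizationDataNonempty) (hCO : PastenComponentOrdersInput) (hCTi : ShimuraCasselsTateLevelInputs)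
    (hLab : ShimuraCarrierLabelsB6FromFive) :
    NonSurjCorner :=
  nonSurjCorner_of_kolyZShaAn_of_twinMuAn_of_fifteenFacts_of_x11aLowerHalf_of_twoPlusFourNamedInputs_of_carrierLabelsB6_pAnchor
    (fun W _ _ p _ N _ K _ _ Dt β ι hX hns h57 hv hnr _ hN hK hdisc hHN hHp hβ hc _ ↦
      hZ W p N K Dt β ι hX hns h57 hv hnr hN hK hdisc hHN hHp hβ hc)
    hμ hF h₃ hG ⟨h₅.2.2.2.2.2.2.2.2.2.2.2.2.1, hJL, hCO, hCTi⟩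
    (fun W _ _ p _ hX _ h57 ↦
      EulerHalfLABIndexGuard.carrierLabelsB6AtFive_of_indexFree h₅.2.2.2.2.2.2.1 h₅.2.2.2.2.2.1 hLab W p hX
        (by rcases h57 with rfl | rfl <;> norm_num))

end Summit.BirchSwinnertonDyer.BirchSwinnertonDyer.Theorems

end
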